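import Summits.NavierStokesRegularity.NavierStokesRegularity.Theorems.CoreLogGasBlowupIsLocallyDrivenCoresCollapse
import Summits.NavierStokesRegularity.NavierStokesRegularity.Theorems.CoreLogGasBlowupIsLocallyDrivenFarFieldReduction

/-!
# `CoreLogGas.BlowupIsLocallyDriven` (stmt-NavierStokesRegularity-11291) is false as soon as ONE maximal solution is
# rigidly strained from afar — negative lemma modulo `RigidFarStrainBlowup` (lead c2 of line `registered`, 2026-08-17)

`--supports stmt-NavierStokesRegularity-11291`, lane `--negative-modulo RigidFarStrainBlowup`.

The crux B (`Theses.CoreLogGas.BlowupIsLocallyDriven`) asks, for EVERY maximal finite-energy classical solution from Clay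
data, for a FIXED truncation multiple `M ≥ 1`, a time `t₀ < T` and an ABSOLUTELY integrable `g` on `[t₀,T)` bounding, at
every admissible triple `(t, x, ρ)` (deep near-maximum vorticity point `x`, canonical core radius `ρ`) and every unit
direction `e`, the symmetric far-strain defect `|⟪(∇u(t,x) − ∇BS[1_{B(x,Mρ)} ω(t)](x)) e, e⟫|`.

**The tightness fact (this file).** Strain has the dimension of `Ω(t) := sup |ω(t,·)|`, and for a maximal solution
`∫^T Ω = ∞` (Beale–Kato–Majda, in-tree `beale_kato_majda_holds`). Hence B fails for ANY maximal solution whose deep peaks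
feel a far strain that is a FRACTION of `Ω(t)` bounded below near `T` — hypothesis `RigidFarStrainBlowup`: for every
`M ≥ 1` there are `c > 0` and `t₁ < T` such that at every `t ∈ [t₁,T)` some admissible triple and unit direction see a
defect `≥ c·Ω(t)`. Proof: B's `g` would dominate `c·Ω` on `[max t₀ t₁, T)`, so `∫ Ω < ∞` there; on the initial slab the
vorticity is bounded (Tao-2013 sub-slab Sobolev bounds, `coresCollapse_hasBoundedSobolevNormsOn`); the BKM integral is
finite and the solution continues past `T`, contradicting maximality
(`hasSmoothExtensionPast_of_iSup_curl_le`, the reusable core; `BlowupIsLocallyDriven_false_of_RigidFarStrainBlowup`).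
The contrapositive is recorded in positive form (`farStrainFraction_dips_of_blowupIsLocallyDriven`): under B, for every
maximal solution, every `M ≥ 1` and every `c > 0`, at times arbitrarily close to `T` ALL admissible triples are strained
from beyond `B(x,Mρ)` by less than `c·Ω(t)` — B forces the far-strain fraction to de-concentrate. Since the one open
stub `stub_shellLocalityCollapse` of line `registered` implies B through landed glue, it is unreachable modulo the same
hypothesis (`shellLocalityCollapse_false_of_RigidFarStrainBlowup`).

**Why this is the content of the refuters' misstatement verdict.** Every frozen-shape (self-similar or discretely
self-similar) collapse model has a far-strain fraction that is a positive SHAPE CONSTANT at fixed `M` — collapsing sheet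
`(2/π)/M`, straight Gaussian tube at its off-axis admissible points `≈ 0.37–0.54/M⁴`, antiparallel pair
`3Γd²/(16πM⁴ρ⁴)`, Gaussian ring `∼ M⁻²`, blob tails `> 0` (evidence files EVIDENCE_11291.md, CRUX_ATTACK_B_11291.md,
CRUX_ATTACK_11127.md, CRUX_ATTACK_11207.md, EVIDENCE.md of alias 10791 on the item) — i.e. a maximal solution collapsing
along any of them is an inhabitant of `RigidFarStrainBlowup`, including the tube / tight-binary / blob branches that B's
docstring files under "locally driven". So B as typed is equivalent to "every finite-time singularity de-concentrates its
far-strain fraction at every fixed `M`", not to the intended tube/binary/blob-versus-sheet trichotomy; the refuters'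
repair is the scale-free quadratic modulus `|defect| ≤ (C/M²)·Ω(t) ∀ M ≥ 1` (Repair.lean on the item).

`RigidFarStrainBlowup` is NOT constructible in the tree: an inhabitant is in particular a finite-time singularity of
Navier–Stokes from Schwartz data (¬ Clay (A)); hence the `--negative-modulo` lane and no verdict change on the item.

References: J. T. Beale, T. Kato, A. Majda, Comm. Math. Phys. 94 (1984), Thm. 1; T. Tao, arXiv:1108.1165, Cor. 11.1.
-/

noncomputable section

open Set MeasureTheory Filter Topology Metric
open scoped ENNReal NNReal

-- justification: the namespace is fixed by the crux protocol (`Theorems/<CruxDecl>/Negative/`).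
set_option linter.dupNamespace false

namespace Summit.NavierStokesRegularity.NavierStokesRegularity.Theorems.BlowupIsLocallyDriven.Negative

open Literature.Analysis.FluidPDE
open Summit.NavierStokesRegularity.NavierStokesRegularity.Theorems.BlowupIsLocallyDriven.Registered

/-! ### The hypothesis -/

/-- **Hypothesis `RigidFarStrainBlowup` (NOT constructible in the tree; filed `--negative-modulo`).** Some maximal
finite-energy classical solution of unforced Navier–Stokes from Clay data (`IsMaximalSmoothSolution` on `[0,T)`,
Leray–Hopf, rapidly decaying datum — exactly the hypotheses of the crux B) is RIGIDLY STRAINED FROM AFAR at its deep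
vorticity peaks: for every truncation multiple `M ≥ 1` there are a fraction `c > 0` and a time `t₁ ∈ [0,T)` such that at
every `t ∈ [t₁,T)` some admissible triple of B — a deep near-maximum point `x` (`Ω(t) ≤ 2|ω(t,x)|`,
`Ω(t) := ⨆ |ω(t,·)|`), an inscribed quarter-max ball `B(x,ρ)`, `ρ` at least half the largest such radius — and some
unit direction `e` see a symmetric far-strain defect `|⟪(∇u(t,x) − ∇BS[1_{B(x,Mρ)} ω(t)](x)) e, e⟫| ≥ c · Ω(t)` (the
Biot–Savart velocity written out exactly as in the crux). Every frozen-shape / discretely self-similar collapse with a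
nonzero far-strain shape constant is of this kind (sheet, off-axis tube, antiparallel pair, ring: refuter model tables
on stmt-NavierStokesRegularity-11291); an inhabitant is in particular a finite-time NS singularity from Schwartz data. -/
def RigidFarStrainBlowup : Prop :=
  ∃ (ν T : ℝ) (u : ℝ → EuclideanSpace ℝ (Fin 3) → EuclideanSpace ℝ (Fin 3))
    (p : ℝ → EuclideanSpace ℝ (Fin 3) → ℝ), 0 < ν ∧ 0 < T ∧
    Literature.Analysis.FluidPDE.IsMaximalSmoothSolution ν 0 u p T ∧
    Literature.Analysis.FluidPDE.IsLerayHopfOn T ν 0 (u 0) u ∧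
    Literature.Analysis.FluidPDE.HasRapidSpatialDecay (u 0) ∧
    ∀ (M : ℝ), 1 ≤ M → ∃ (c : ℝ), 0 < c ∧ ∃ t₁ ∈ Set.Ico 0 T, ∀ t ∈ Set.Ico t₁ T,
      ∃ (x : EuclideanSpace ℝ (Fin 3)) (ρ : ℝ), 0 < ρ ∧
        (⨆ z, ‖Literature.Analysis.FluidPDE.curl (u t) z‖) ≤ 2 * ‖Literature.Analysis.FluidPDE.curl (u t) x‖ ∧
        Metric.ball x ρ ⊆ {y | (⨆ z, ‖Literature.Analysis.FluidPDE.curl (u t) z‖) ≤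
          4 * ‖Literature.Analysis.FluidPDE.curl (u t) y‖} ∧
        (∀ (x' : EuclideanSpace ℝ (Fin 3)) (ρ' : ℝ),
          (⨆ z, ‖Literature.Analysis.FluidPDE.curl (u t) z‖) ≤ 2 * ‖Literature.Analysis.FluidPDE.curl (u t) x'‖ →
          Metric.ball x' ρ' ⊆ {y | (⨆ z, ‖Literature.Analysis.FluidPDE.curl (u t) z‖) ≤
            4 * ‖Literature.Analysis.FluidPDE.curl (u t) y‖} → ρ' ≤ 2 * ρ) ∧
        ∃ e : EuclideanSpace ℝ (Fin 3), ‖e‖ = 1 ∧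
          c * (⨆ z, ‖Literature.Analysis.FluidPDE.curl (u t) z‖) ≤
            |inner ℝ ((fderiv ℝ (u t) x - fderiv ℝ (fun z : EuclideanSpace ℝ (Fin 3) =>
              ∫ y, (4 * Real.pi * ‖z - y‖ ^ 3)⁻¹ • Literature.Analysis.FluidPDE.cross
                ((Metric.ball x (M * ρ)).indicator (Literature.Analysis.FluidPDE.curl (u t)) y) (z - y)) x) e) e|

/-! ### The reusable core: an integrable majorant of `Ω` near `T` continues the solution -/

/-- **Beale–Kato–Majda with an integrable majorant on a final interval.** If a classical Leray–Hopf solution from a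
rapidly decaying datum on `[0,T)` has `Ω(t) = ⨆ |ω(t,·)| ≤ G(t)` on some final interval `[t₂,T)` with `G` integrable
there, then it extends smoothly past `T`: on `[0, max t₂ (T/2)]` the vorticity is bounded (sub-slab Sobolev bounds), so
the BKM integral `∫₀ᵀ ‖ω‖_∞` is finite. [cite: BealeKatoMajda1984, Theorem 1] -/
theorem hasSmoothExtensionPast_of_iSup_curl_le {ν T : ℝ} (hν : 0 < ν) (hT : 0 < T)
    {u : ℝ → EuclideanSpace ℝ (Fin 3) → EuclideanSpace ℝ (Fin 3)} {p : ℝ → EuclideanSpace ℝ (Fin 3) → ℝ}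
    (hcl : IsClassicalNSSolutionOn (Ico 0 T) ν 0 u p) (hLH : IsLerayHopfOn T ν 0 (u 0) u)
    (hdec : HasRapidSpatialDecay (u 0)) {t₂ : ℝ} (ht₂ : t₂ ∈ Ico 0 T) {G : ℝ → ℝ}
    (hG : IntegrableOn G (Ico t₂ T)) (hle : ∀ t ∈ Ico t₂ T, (⨆ z, ‖curl (u t) z‖) ≤ G t) :
    HasSmoothExtensionPast ν 0 u T := by
  -- the vorticity is bounded on `[0, max t₂ (T/2)]`
  have hreg := coresCollapse_hasBoundedSobolevNormsOn hν hT hcl hLH hdec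
  have ht₃ : max t₂ (T / 2) < T := max_lt ht₂.2 (by linarith)
  obtain ⟨R₁, hR₁, hR₁b⟩ := exists_enorm_curl_le_of_hasBoundedSobolevNormsOn
    (fun s hs => hcl.contDiff_velocity ⟨hs.1, hs.2.trans_lt ht₃⟩) (hreg _ ht₃)
  -- a pointwise majorant of the BKM integrand on `(0, T)`
  set G' : ℝ → ℝ := (Ico t₂ T).indicator G with hG'
  have hbound : ∀ t ∈ Ioo 0 T, (⨆ z, ‖curl (u t) z‖ₑ) ≤ R₁ + ENNReal.ofReal (G' t) := by
    intro t ht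
    refine iSup_le fun z => ?_
    rcases le_or_gt t (max t₂ (T / 2)) with h | h
    · exact (hR₁b t ⟨ht.1.le, h⟩ z).trans le_self_add
    · have htI : t ∈ Ico t₂ T := ⟨(le_max_left _ _).trans h.le, ht.2⟩
      have ht' : t ∈ Ico 0 T := ⟨ht.1.le, ht.2⟩
      have hwb := coresCollapse_bddAbove_curl hν hT hcl hLH hdec ht'
      calc ‖curl (u t) z‖ₑ = ENNReal.ofReal ‖curl (u t) z‖ := (ofReal_norm _).symm
        _ ≤ ENNReal.ofReal (⨆ z, ‖curl (u t) z‖) := ENNReal.ofReal_le_ofReal (le_ciSup hwb z)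
        _ ≤ ENNReal.ofReal (G' t) := ENNReal.ofReal_le_ofReal (by
            rw [hG', indicator_of_mem htI]; exact hle t htI)
        _ ≤ R₁ + ENNReal.ofReal (G' t) := le_add_self
  -- the BKM integral is finite
  have hGi : IntegrableOn G' (Ioo 0 T) volume := by
    have h1 : IntegrableOn G' (Ico t₂ T) volume :=
      hG.congr_fun (fun t ht => by rw [hG', indicator_of_mem ht]) measurableSet_Ico
    have h2 : Integrable G' volume := by
      rw [← integrableOn_univ, ← union_compl_self (Ico t₂ T), integrableOn_union]
      refine ⟨h1, ?_⟩
      refine (integrableOn_zero (s := (Ico t₂ T)ᶜ)).congr_fun (fun t ht => ?_) (measurableSet_Ico.compl)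
      rw [hG', indicator_of_notMem ht]
    exact h2.integrableOn
  have hfin : (∫⁻ t in Ioo 0 T, ⨆ z, ‖curl (u t) z‖ₑ) < ⊤ := by
    calc (∫⁻ t in Ioo 0 T, ⨆ z, ‖curl (u t) z‖ₑ)
        ≤ ∫⁻ t in Ioo 0 T, (R₁ + ENNReal.ofReal (G' t)) := setLIntegral_mono' measurableSet_Ioo hbound
      _ = (∫⁻ _ in Ioo 0 T, R₁) + ∫⁻ t in Ioo 0 T, ENNReal.ofReal (G' t) := by
          rw [lintegral_add_left' aemeasurable_const]
      _ < ⊤ := by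
          refine ENNReal.add_lt_top.2 ⟨?_, ?_⟩
          · rw [setLIntegral_const, Real.volume_Ioo]
            exact ENNReal.mul_lt_top hR₁ ENNReal.ofReal_lt_top
          · calc (∫⁻ t in Ioo 0 T, ENNReal.ofReal (G' t)) ≤ ∫⁻ t in Ioo 0 T, ‖G' t‖ₑ :=
                  lintegral_mono fun t => Real.ofReal_le_enorm _
              _ < ⊤ := hGi.2
  -- Beale–Kato–Majda continues the solution past `T`
  exact ((beale_kato_majda_holds hν.le hT hcl hreg).2 hfin).hasSmoothExtensionPast

/-! ### The negative lemma -/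

/-- **Locality at `M` and rigidity at the same `M` are incompatible on one maximal solution.** If a maximal classical
Leray–Hopf solution from decaying data satisfies B's locality clause with data `(M, t₀, g)`, `g` integrable on `[t₀,T)`,
and from some `t₁ < T` on every time carries an admissible triple and a unit direction with far-strain defect
`≥ c · Ω(t)`, `c > 0`, then `Ω ≤ g/c` on `[max t₀ t₁, T)` and the solution would continue past `T`. -/
theorem false_of_locality_of_rigid {ν T : ℝ} (hν : 0 < ν) (hT : 0 < T)
    {u : ℝ → EuclideanSpace ℝ (Fin 3) → EuclideanSpace ℝ (Fin 3)} {p : ℝ → EuclideanSpace ℝ (Fin 3) → ℝ}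
    (hmax : IsMaximalSmoothSolution ν 0 u p T) (hLH : IsLerayHopfOn T ν 0 (u 0) u)
    (hdec : HasRapidSpatialDecay (u 0)) {M t₀ : ℝ} {g : ℝ → ℝ} (ht₀ : t₀ ∈ Ico 0 T)
    (hg : IntegrableOn g (Ico t₀ T))
    (hloc : ∀ t ∈ Set.Ico t₀ T, ∀ (x : EuclideanSpace ℝ (Fin 3)) (ρ : ℝ), 0 < ρ →
      (⨆ z, ‖curl (u t) z‖) ≤ 2 * ‖curl (u t) x‖ →
      Metric.ball x ρ ⊆ {y | (⨆ z, ‖curl (u t) z‖) ≤ 4 * ‖curl (u t) y‖} →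
      (∀ (x' : EuclideanSpace ℝ (Fin 3)) (ρ' : ℝ), (⨆ z, ‖curl (u t) z‖) ≤ 2 * ‖curl (u t) x'‖ →
        Metric.ball x' ρ' ⊆ {y | (⨆ z, ‖curl (u t) z‖) ≤ 4 * ‖curl (u t) y‖} → ρ' ≤ 2 * ρ) →
      ∀ e : EuclideanSpace ℝ (Fin 3), ‖e‖ = 1 →
        |inner ℝ ((fderiv ℝ (u t) x - fderiv ℝ (fun z : EuclideanSpace ℝ (Fin 3) =>
          ∫ y, (4 * Real.pi * ‖z - y‖ ^ 3)⁻¹ • cross ((Metric.ball x (M * ρ)).indicator (curl (u t)) y) (z - y)) x)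
            e) e| ≤ g t)
    {c t₁ : ℝ} (hc : 0 < c) (ht₁ : t₁ ∈ Ico 0 T)
    (hrig : ∀ t ∈ Set.Ico t₁ T, ∃ (x : EuclideanSpace ℝ (Fin 3)) (ρ : ℝ), 0 < ρ ∧
      (⨆ z, ‖curl (u t) z‖) ≤ 2 * ‖curl (u t) x‖ ∧
      Metric.ball x ρ ⊆ {y | (⨆ z, ‖curl (u t) z‖) ≤ 4 * ‖curl (u t) y‖} ∧
      (∀ (x' : EuclideanSpace ℝ (Fin 3)) (ρ' : ℝ), (⨆ z, ‖curl (u t) z‖) ≤ 2 * ‖curl (u t) x'‖ →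
        Metric.ball x' ρ' ⊆ {y | (⨆ z, ‖curl (u t) z‖) ≤ 4 * ‖curl (u t) y‖} → ρ' ≤ 2 * ρ) ∧
      ∃ e : EuclideanSpace ℝ (Fin 3), ‖e‖ = 1 ∧
        c * (⨆ z, ‖curl (u t) z‖) ≤
          |inner ℝ ((fderiv ℝ (u t) x - fderiv ℝ (fun z : EuclideanSpace ℝ (Fin 3) =>
            ∫ y, (4 * Real.pi * ‖z - y‖ ^ 3)⁻¹ • cross ((Metric.ball x (M * ρ)).indicator (curl (u t)) y) (z - y)) x)
              e) e|) :
    False := by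
  -- on `[max t₀ t₁, T)` the vorticity maximum is dominated by `g / c`
  have ht₂ : max t₀ t₁ ∈ Ico 0 T := ⟨ht₀.1.trans (le_max_left _ _), max_lt ht₀.2 ht₁.2⟩
  have hle : ∀ t ∈ Ico (max t₀ t₁) T, (⨆ z, ‖curl (u t) z‖) ≤ g t / c := by
    intro t ht
    obtain ⟨x, ρ, hρ, h1, h2, h3, e, he, hce⟩ := hrig t ⟨(le_max_right _ _).trans ht.1, ht.2⟩
    have hg_t := hloc t ⟨(le_max_left _ _).trans ht.1, ht.2⟩ x ρ hρ h1 h2 h3 e he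
    rw [le_div_iff₀ hc, mul_comm]
    exact hce.trans hg_t
  have hgc : IntegrableOn (fun t => g t / c) (Ico (max t₀ t₁) T) :=
    (hg.mono_set (Ico_subset_Ico_left (le_max_left _ _))).div_const c
  exact hmax.2 (hasSmoothExtensionPast_of_iSup_curl_le hν hT hmax.1 hLH hdec ht₂ hgc hle)

/-- **Negative lemma modulo `RigidFarStrainBlowup`.** If some maximal finite-energy classical solution from Clay data is
rigidly strained from afar at its deep vorticity peaks (far-strain fraction `≥ c(M) > 0` near `T` for every `M ≥ 1`),
then the crux B `CoreLogGas.BlowupIsLocallyDriven` (fixed `M`, ABSOLUTELY integrable bound `g`) is false: B's `g` would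
dominate `c·Ω(t)` on a final interval, forcing `∫^T Ω < ∞` and hence continuation past `T` by Beale–Kato–Majda
(`hasSmoothExtensionPast_of_iSup_curl_le`), against maximality. -/
theorem BlowupIsLocallyDriven_false_of_RigidFarStrainBlowup (hH : RigidFarStrainBlowup) :
    ¬ Theses.CoreLogGas.BlowupIsLocallyDriven := by
  intro hB
  obtain ⟨ν, T, u, p, hν, hT, hmax, hLH, hdec, hrig⟩ := hH
  obtain ⟨M, t₀, g, hM, ht₀, ht₀T, hg, hloc⟩ := hB ν T hν hT u p hmax hLH hdec
  obtain ⟨c, hc, t₁, ht₁, hfrac⟩ := hrig M hM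
  exact false_of_locality_of_rigid hν hT hmax hLH hdec ⟨ht₀, ht₀T⟩ hg hloc hc ht₁ hfrac

/-- **The registered stub is unreachable modulo the same hypothesis.** The one open stub `stub_shellLocalityCollapse` of
line `registered` (shell locality in the collapsing-core regime, statement verbatim) implies B through the landed glue
`blowupIsLocallyDriven_of_shellLocality ∘ shellLocality_of_collapseCase`; hence it, too, is refuted by any rigidly
far-strained maximal solution. -/
theorem shellLocalityCollapse_false_of_RigidFarStrainBlowup (hH : RigidFarStrainBlowup) :
    ¬ (∀ (ν T : ℝ), 0 < ν → 0 < T →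
    ∀ (u : ℝ → EuclideanSpace ℝ (Fin 3) → EuclideanSpace ℝ (Fin 3)) (p : ℝ → EuclideanSpace ℝ (Fin 3) → ℝ),
      Literature.Analysis.FluidPDE.IsMaximalSmoothSolution ν 0 u p T →
      Literature.Analysis.FluidPDE.IsLerayHopfOn T ν 0 (u 0) u →
      Literature.Analysis.FluidPDE.HasRapidSpatialDecay (u 0) →
      (∀ (ρ₀ : ℝ), 0 < ρ₀ → ∀ t₁ ∈ Set.Ico 0 T, ∃ t ∈ Set.Ico t₁ T,
        ∃ (x : EuclideanSpace ℝ (Fin 3)) (ρ : ℝ), 0 < ρ ∧ ρ < ρ₀ ∧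
          (⨆ z, ‖Literature.Analysis.FluidPDE.curl (u t) z‖) ≤ 2 * ‖Literature.Analysis.FluidPDE.curl (u t) x‖ ∧
          Metric.ball x ρ ⊆ {y | (⨆ z, ‖Literature.Analysis.FluidPDE.curl (u t) z‖) ≤
            4 * ‖Literature.Analysis.FluidPDE.curl (u t) y‖} ∧
          (∀ (x' : EuclideanSpace ℝ (Fin 3)) (ρ' : ℝ),
            (⨆ z, ‖Literature.Analysis.FluidPDE.curl (u t) z‖) ≤ 2 * ‖Literature.Analysis.FluidPDE.curl (u t) x'‖ →
            Metric.ball x' ρ' ⊆ {y | (⨆ z, ‖Literature.Analysis.FluidPDE.curl (u t) z‖) ≤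
              4 * ‖Literature.Analysis.FluidPDE.curl (u t) y‖} → ρ' ≤ 2 * ρ)) →
      ∃ (M t₀ R : ℝ) (g₁ : ℝ → ℝ), 1 ≤ M ∧ 0 ≤ t₀ ∧ t₀ < T ∧ 0 < R ∧
        MeasureTheory.IntegrableOn g₁ (Set.Ico t₀ T) ∧
        ∀ t ∈ Set.Ico t₀ T, ∀ (x : EuclideanSpace ℝ (Fin 3)) (ρ : ℝ), 0 < ρ → M * ρ ≤ R →
          (⨆ z, ‖Literature.Analysis.FluidPDE.curl (u t) z‖) ≤ 2 * ‖Literature.Analysis.FluidPDE.curl (u t) x‖ →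
          Metric.ball x ρ ⊆ {y | (⨆ z, ‖Literature.Analysis.FluidPDE.curl (u t) z‖) ≤
            4 * ‖Literature.Analysis.FluidPDE.curl (u t) y‖} →
          (∀ (x' : EuclideanSpace ℝ (Fin 3)) (ρ' : ℝ),
            (⨆ z, ‖Literature.Analysis.FluidPDE.curl (u t) z‖) ≤ 2 * ‖Literature.Analysis.FluidPDE.curl (u t) x'‖ →
            Metric.ball x' ρ' ⊆ {y | (⨆ z, ‖Literature.Analysis.FluidPDE.curl (u t) z‖) ≤
              4 * ‖Literature.Analysis.FluidPDE.curl (u t) y‖} → ρ' ≤ 2 * ρ) →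
          ∀ e : EuclideanSpace ℝ (Fin 3), ‖e‖ = 1 →
            |inner ℝ ((fderiv ℝ (fun z : EuclideanSpace ℝ (Fin 3) => ∫ y, (4 * Real.pi * ‖z - y‖ ^ 3)⁻¹ •
                Literature.Analysis.FluidPDE.cross ((Metric.ball x R).indicator
                  (Literature.Analysis.FluidPDE.curl (u t)) y) (z - y)) x
              - fderiv ℝ (fun z : EuclideanSpace ℝ (Fin 3) => ∫ y, (4 * Real.pi * ‖z - y‖ ^ 3)⁻¹ •
                Literature.Analysis.FluidPDE.cross ((Metric.ball x (M * ρ)).indicator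
                  (Literature.Analysis.FluidPDE.curl (u t)) y) (z - y)) x) e) e| ≤ g₁ t) := fun hstub =>
  BlowupIsLocallyDriven_false_of_RigidFarStrainBlowup hH
    (blowupIsLocallyDriven_of_shellLocality (shellLocality_of_collapseCase hstub))

/-- **B forces the far-strain fraction to de-concentrate (contrapositive, positive form).** Under
`CoreLogGas.BlowupIsLocallyDriven`, every maximal finite-energy classical solution from Clay data admits a truncation
multiple `M ≥ 1` (the one B supplies) such that for every level `c > 0` and every `t₁ < T` there is a time `t ∈ [t₁,T)`
at which EVERY admissible triple `(x, ρ)` and every unit direction `e` see a far-strain defect `< c · Ω(t)`: the fraction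
(far strain beyond `B(x,Mρ)`)/(vorticity maximum) dips below every positive level at times arbitrarily close to `T`. -/
theorem farStrainFraction_dips_of_blowupIsLocallyDriven (hB : Theses.CoreLogGas.BlowupIsLocallyDriven) :
    ∀ (ν T : ℝ), 0 < ν → 0 < T →
    ∀ (u : ℝ → EuclideanSpace ℝ (Fin 3) → EuclideanSpace ℝ (Fin 3)) (p : ℝ → EuclideanSpace ℝ (Fin 3) → ℝ),
      Literature.Analysis.FluidPDE.IsMaximalSmoothSolution ν 0 u p T →
      Literature.Analysis.FluidPDE.IsLerayHopfOn T ν 0 (u 0) u →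
      Literature.Analysis.FluidPDE.HasRapidSpatialDecay (u 0) →
      ∃ (M : ℝ), 1 ≤ M ∧ ∀ (c : ℝ), 0 < c → ∀ t₁ ∈ Set.Ico 0 T, ∃ t ∈ Set.Ico t₁ T,
        ∀ (x : EuclideanSpace ℝ (Fin 3)) (ρ : ℝ), 0 < ρ →
          (⨆ z, ‖Literature.Analysis.FluidPDE.curl (u t) z‖) ≤ 2 * ‖Literature.Analysis.FluidPDE.curl (u t) x‖ →
          Metric.ball x ρ ⊆ {y | (⨆ z, ‖Literature.Analysis.FluidPDE.curl (u t) z‖) ≤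
            4 * ‖Literature.Analysis.FluidPDE.curl (u t) y‖} →
          (∀ (x' : EuclideanSpace ℝ (Fin 3)) (ρ' : ℝ),
            (⨆ z, ‖Literature.Analysis.FluidPDE.curl (u t) z‖) ≤ 2 * ‖Literature.Analysis.FluidPDE.curl (u t) x'‖ →
            Metric.ball x' ρ' ⊆ {y | (⨆ z, ‖Literature.Analysis.FluidPDE.curl (u t) z‖) ≤
              4 * ‖Literature.Analysis.FluidPDE.curl (u t) y‖} → ρ' ≤ 2 * ρ) →
          ∀ e : EuclideanSpace ℝ (Fin 3), ‖e‖ = 1 →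
            |inner ℝ ((fderiv ℝ (u t) x - fderiv ℝ (fun z : EuclideanSpace ℝ (Fin 3) =>
              ∫ y, (4 * Real.pi * ‖z - y‖ ^ 3)⁻¹ • Literature.Analysis.FluidPDE.cross
                ((Metric.ball x (M * ρ)).indicator (Literature.Analysis.FluidPDE.curl (u t)) y) (z - y)) x) e) e| <
              c * (⨆ z, ‖Literature.Analysis.FluidPDE.curl (u t) z‖) := by
  intro ν T hν hT u p hmax hLH hdec
  obtain ⟨M, t₀, g, hM, ht₀, ht₀T, hg, hloc⟩ := hB ν T hν hT u p hmax hLH hdec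
  refine ⟨M, hM, fun c hc t₁ ht₁ => ?_⟩
  by_contra hno
  push Not at hno
  refine false_of_locality_of_rigid hν hT hmax hLH hdec ⟨ht₀, ht₀T⟩ hg hloc hc ht₁ fun t ht => ?_
  obtain ⟨x, ρ, hρ, h1, h2, h3, e, he, hce⟩ := hno t ht
  exact ⟨x, ρ, hρ, h1, h2, h3, e, he, hce⟩

end Summit.NavierStokesRegularity.NavierStokesRegularity.Theorems.BlowupIsLocallyDriven.Negative

end
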